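import Literature.NumberTheory.LFunctions.ZetaScrew
import Summits.RiemannHypothesis.RiemannHypothesis.Theorems.Splittings.ScrewNullCombUniqueness

/-!
# Splittings — SCREW NULL COMBINATIONS II: a node-vanishing combination of kernel sections tends to zero (prime side)

Cell rh-split (brief sha16 f79c5f09d8bcb036), seat rh-split-typer-2 g3 (prover; own initiative on the cross/screw column,
announced HOME/STATUS.md 01:50Z): residual **R2** of target T2 (`ETAIL ⟺ FOZ`) of `cards/SPLIT-screw-bridge.md` §8/§9.  The seat
rh-split-screw-bridge g4 re-expressed R2 («FOZ ⟹ the screw Gram matrices are eventually nonsingular») as «FOZ ⟹ NNC»,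
NNC = «no non-zero finite real combination `t ↦ Σ_{j<n} z_j G_g(t, log(j+2))` of kernel sections vanishes at every node
`log(i+2)`» (`Splittings/ScrewBridgeRigidity.lean`, `inertiaOfFoz_iff_foz_imp_nnc`).  This file is part II of VI, step (i):
if `F(t) = Σ_j G_g(t, log(j+2)) z_j` vanishes at every node `log m` (`m ≥ 2`), then `F(t) → 0` as `t → +∞`
(`tendsto_nodeComb_zero`).  Mechanism: Suzuki's prime-side formula (1.1) for `Ψ` (tree `zetaScrew_eq`) gives a Lipschitz bound
`|Ψ(t) − Ψ(s)| ≤ (2(e^{b/2}+1) + 2√M log M + |L₀|/2)|t−s| + (C/2)e^{−a/2}` on `[a,b]`, `e^b ≤ M` (`abs_zetaScrew_sub_le`; only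
`Λ(n) ≤ log n` and `Σ_{n≤M} n^{-1/2} ≤ 2√M` are used, no prime number theorem), and the nodes `log m` have gaps `1/m`, so
`|F(t)| ≪ (t+2)e^{−t/2}` (`abs_nodeComb_le`).  All [folklore].

HONEST LABEL: an RH-free theorem about Suzuki's screw kernel GIVEN finitely many off-line zeros; it discharges the residual
R2 of a CONDITIONAL bridge (cell rh-split: «SPLITTING SEARCH over kernel-typed RH-EQUIVALENCES; a splitting A ∧ B ⟹ RH is
CONDITIONAL bookkeeping unless A and B are both proved») and nothing here bears on the truth of RH.
-/

set_option linter.dupNamespace false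

noncomputable section

namespace Summit.RiemannHypothesis.RiemannHypothesis.Theorems.Splittings.ScrewNullComb


open Filter Topology Real Finset
open Literature.NumberTheory.LFunctions

/-! ## Elementary Lipschitz estimates -/

/-- `Σ_{1 ≤ n ≤ M} Λ(n)/√n ≤ 2√M log M` (trivial bound `Λ(n) ≤ log n ≤ log M`). [folklore] -/
theorem sum_vonMangoldt_div_sqrt_le (M : ℕ) :
    ∑ n ∈ Icc 1 M, ArithmeticFunction.vonMangoldt n / Real.sqrt n ≤ Real.log M * (2 * Real.sqrt M) := by
  calc ∑ n ∈ Icc 1 M, ArithmeticFunction.vonMangoldt n / Real.sqrt n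
      ≤ ∑ n ∈ Icc 1 M, Real.log M * (1 / Real.sqrt n) := by
        refine Finset.sum_le_sum fun n hn ↦ ?_
        rw [Finset.mem_Icc] at hn
        have hn0 : (0 : ℝ) < n := by exact_mod_cast hn.1
        rw [div_eq_mul_one_div]
        refine mul_le_mul_of_nonneg_right ?_ (by positivity)
        exact ArithmeticFunction.vonMangoldt_le_log.trans (Real.log_le_log hn0 (by exact_mod_cast hn.2))
    _ = Real.log M * ∑ n ∈ Icc 1 M, 1 / Real.sqrt n := by rw [Finset.mul_sum]
    _ ≤ Real.log M * (2 * Real.sqrt M) :=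
        mul_le_mul_of_nonneg_left (sum_one_div_sqrt_le M) (Real.log_natCast_nonneg M)

/-- **Prime-sum Lipschitz bound**: for `0 ≤ s, t` with `e^s, e^t ≤ M`,
`|φ(t) − φ(s)| ≤ (Σ_{n ≤ M} Λ(n)/√n)·|t − s|` (each summand `Λ(n)n^{-1/2} max(t − log n, 0)` is Lipschitz).
[folklore] -/
theorem abs_primeSum_sub_le {s t : ℝ} {M : ℕ} (hs : 0 ≤ s) (ht : 0 ≤ t) (hsM : Real.exp s ≤ M)
    (htM : Real.exp t ≤ M) :
    |zetaScrewPrimeSum t - zetaScrewPrimeSum s| ≤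
      (∑ n ∈ Icc 1 M, ArithmeticFunction.vonMangoldt n / Real.sqrt n) * |t - s| := by
  rw [zetaScrewPrimeSum_eq_sum_max (t := t) (by rwa [abs_of_nonneg ht]),
    zetaScrewPrimeSum_eq_sum_max (t := s) (by rwa [abs_of_nonneg hs]), ← Finset.sum_sub_distrib,
    Finset.sum_mul]
  refine (Finset.abs_sum_le_sum_abs _ _).trans (Finset.sum_le_sum fun n _ ↦ ?_)
  rw [← mul_sub, abs_mul,
    abs_of_nonneg (div_nonneg ArithmeticFunction.vonMangoldt_nonneg (Real.sqrt_nonneg _))]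
  refine mul_le_mul_of_nonneg_left ?_ (div_nonneg ArithmeticFunction.vonMangoldt_nonneg (Real.sqrt_nonneg _))
  rw [abs_of_nonneg ht, abs_of_nonneg hs]
  calc |max (t - Real.log n) 0 - max (s - Real.log n) 0|
      ≤ |(t - Real.log n) - (s - Real.log n)| := abs_max_sub_max_le_abs _ _ _
    _ = |t - s| := by ring_nf

/-- **Lipschitz-type bound for `Ψ` on `[a, b] ⊂ [0, ∞)`** (`e^b ≤ M`): the archimedean, prime and linear parts of
Suzuki's (1.1) are Lipschitz with the displayed constants, and the Hurwitz–Lerch part `¼e^{-t/2}Φ(e^{-2t},2,¼)` is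
non-negative and at most `¼ C e^{-a/2}` (`C = Σ (k+¼)^{-2}`), so it oscillates by at most `(C/2)e^{-a/2}`. [folklore] -/
theorem abs_zetaScrew_sub_le {a b s t : ℝ} {M : ℕ} (ha : 0 ≤ a) (hs : s ∈ Set.Icc a b)
    (ht : t ∈ Set.Icc a b) (hM : Real.exp b ≤ M) :
    |zetaScrew t - zetaScrew s| ≤
      (2 * (Real.exp (b / 2) + 1) + Real.log M * (2 * Real.sqrt M)
          + |Real.eulerMascheroniConstant + π / 2 + 3 * Real.log 2 + Real.log π| / 2) * |t - s|
        + (∑' k : ℕ, 1 / ((k : ℝ) + 1 / 4) ^ 2) / 2 * Real.exp (-(a / 2)) := by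
  have hs0 : 0 ≤ s := ha.trans hs.1
  have ht0 : 0 ≤ t := ha.trans ht.1
  set L₀ : ℝ := Real.eulerMascheroniConstant + π / 2 + 3 * Real.log 2 + Real.log π with hL₀
  set C : ℝ := ∑' k : ℕ, 1 / ((k : ℝ) + 1 / 4) ^ 2 with hC
  -- the four differences
  set D₁ : ℝ := 4 * (Real.exp (t / 2) + Real.exp (-(t / 2)) - 2) - 4 * (Real.exp (s / 2) + Real.exp (-(s / 2)) - 2)
    with hD₁
  set D₂ : ℝ := zetaScrewPrimeSum t - zetaScrewPrimeSum s with hD₂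
  set D₃ : ℝ := t / 2 * L₀ - s / 2 * L₀ with hD₃
  set D₄ : ℝ := (1 / 4 : ℝ) * (Real.exp (-(s / 2)) * hurwitzLerchQuarter s - Real.exp (-(t / 2)) * hurwitzLerchQuarter t)
    with hD₄
  have hdiff : zetaScrew t - zetaScrew s = D₁ - D₂ - D₃ + D₄ := by
    rw [zetaScrew_eq t, zetaScrew_eq s, abs_of_nonneg ht0, abs_of_nonneg hs0, hD₁, hD₂, hD₃, hD₄]
    ring
  -- |D₁|
  have h1 : |D₁| ≤ 2 * (Real.exp (b / 2) + 1) * |t - s| := by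
    -- `|e^x − e^y| ≤ e^B |x − y|` for `x, y ≤ B` (convexity `1 + u ≤ e^u`)
    have key : ∀ {x y B : ℝ}, y ≤ x → x ≤ B → |Real.exp x - Real.exp y| ≤ Real.exp B * |x - y| := by
      intro x y B hyx hxB
      have e : Real.exp x - Real.exp y = Real.exp x * (1 - Real.exp (y - x)) := by
        rw [mul_sub, mul_one, ← Real.exp_add, add_sub_cancel]
      have h2 : 1 - Real.exp (y - x) ≤ x - y := by linarith [Real.add_one_le_exp (y - x)]
      rw [abs_of_nonneg (sub_nonneg.2 (Real.exp_le_exp.2 hyx)), abs_of_nonneg (sub_nonneg.2 hyx), e]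
      calc Real.exp x * (1 - Real.exp (y - x)) ≤ Real.exp x * (x - y) :=
            mul_le_mul_of_nonneg_left h2 (Real.exp_pos x).le
        _ ≤ Real.exp B * (x - y) := mul_le_mul_of_nonneg_right (Real.exp_le_exp.2 hxB) (by linarith)
    have abs_exp_sub_exp_le : ∀ {x y B : ℝ}, x ≤ B → y ≤ B → |Real.exp x - Real.exp y| ≤ Real.exp B * |x - y| := by
      intro x y B hx hy
      rcases le_total y x with h | h
      · exact key h hx
      · rw [abs_sub_comm, abs_sub_comm x y]; exact key h hy
    have e1 : D₁ = 4 * ((Real.exp (t / 2) - Real.exp (s / 2)) + (Real.exp (-(t / 2)) - Real.exp (-(s / 2)))) := by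
      rw [hD₁]; ring
    have ha1 := abs_exp_sub_exp_le (x := t / 2) (y := s / 2) (B := b / 2) (by linarith [ht.2]) (by linarith [hs.2])
    have ha2 := abs_exp_sub_exp_le (x := -(t / 2)) (y := -(s / 2)) (B := 0) (by linarith) (by linarith)
    rw [Real.exp_zero, one_mul] at ha2
    have e2 : |t / 2 - s / 2| = |t - s| / 2 := by
      rw [show t / 2 - s / 2 = (t - s) / 2 by ring, abs_div, abs_two]
    have e3 : |-(t / 2) - -(s / 2)| = |t - s| / 2 := by
      rw [show -(t / 2) - -(s / 2) = (s - t) / 2 by ring, abs_div, abs_two, abs_sub_comm]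
    rw [e2] at ha1
    rw [e3] at ha2
    rw [e1, abs_mul, show |(4 : ℝ)| = 4 by norm_num]
    calc 4 * |Real.exp (t / 2) - Real.exp (s / 2) + (Real.exp (-(t / 2)) - Real.exp (-(s / 2)))|
        ≤ 4 * (|Real.exp (t / 2) - Real.exp (s / 2)| + |Real.exp (-(t / 2)) - Real.exp (-(s / 2))|) := by
          gcongr; exact abs_add_le _ _
      _ ≤ 4 * (Real.exp (b / 2) * (|t - s| / 2) + |t - s| / 2) := by gcongr
      _ = 2 * (Real.exp (b / 2) + 1) * |t - s| := by ring
  -- |D₂|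
  have h2 : |D₂| ≤ Real.log M * (2 * Real.sqrt M) * |t - s| := by
    have hsM : Real.exp s ≤ M := (Real.exp_le_exp.2 hs.2).trans hM
    have htM : Real.exp t ≤ M := (Real.exp_le_exp.2 ht.2).trans hM
    exact (abs_primeSum_sub_le hs0 ht0 hsM htM).trans
      (mul_le_mul_of_nonneg_right (sum_vonMangoldt_div_sqrt_le M) (abs_nonneg _))
  -- |D₃|
  have h3 : |D₃| = |L₀| / 2 * |t - s| := by
    rw [hD₃, show t / 2 * L₀ - s / 2 * L₀ = L₀ / 2 * (t - s) by ring, abs_mul, abs_div, abs_two]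
  -- |D₄|
  have h4 : |D₄| ≤ C / 2 * Real.exp (-(a / 2)) := by
    have hΦs := hurwitzLerchQuarter_nonneg s
    have hΦt := hurwitzLerchQuarter_nonneg t
    have hΦs' : hurwitzLerchQuarter s ≤ C := hurwitzLerchQuarter_le s
    have hΦt' : hurwitzLerchQuarter t ≤ C := hurwitzLerchQuarter_le t
    have hes : Real.exp (-(s / 2)) ≤ Real.exp (-(a / 2)) := Real.exp_le_exp.2 (by linarith [hs.1])
    have het : Real.exp (-(t / 2)) ≤ Real.exp (-(a / 2)) := Real.exp_le_exp.2 (by linarith [ht.1])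
    have hps : 0 ≤ Real.exp (-(s / 2)) * hurwitzLerchQuarter s := by positivity
    have hpt : 0 ≤ Real.exp (-(t / 2)) * hurwitzLerchQuarter t := by positivity
    have hbs : Real.exp (-(s / 2)) * hurwitzLerchQuarter s ≤ Real.exp (-(a / 2)) * C :=
      mul_le_mul hes hΦs' hΦs (Real.exp_pos _).le
    have hbt : Real.exp (-(t / 2)) * hurwitzLerchQuarter t ≤ Real.exp (-(a / 2)) * C :=
      mul_le_mul het hΦt' hΦt (Real.exp_pos _).le
    rw [hD₄, abs_mul, show |(1 / 4 : ℝ)| = 1 / 4 by norm_num]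
    have : |Real.exp (-(s / 2)) * hurwitzLerchQuarter s - Real.exp (-(t / 2)) * hurwitzLerchQuarter t|
        ≤ 2 * (Real.exp (-(a / 2)) * C) := by
      rw [abs_le]; constructor <;> linarith
    calc (1 / 4 : ℝ) * |Real.exp (-(s / 2)) * hurwitzLerchQuarter s - Real.exp (-(t / 2)) * hurwitzLerchQuarter t|
        ≤ (1 / 4 : ℝ) * (2 * (Real.exp (-(a / 2)) * C)) := by gcongr
      _ = C / 2 * Real.exp (-(a / 2)) := by ring
  -- assemble
  rw [hdiff]
  calc |D₁ - D₂ - D₃ + D₄| ≤ |D₁| + |D₂| + |D₃| + |D₄| := by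
        calc |D₁ - D₂ - D₃ + D₄| ≤ |D₁ - D₂ - D₃| + |D₄| := abs_add_le _ _
          _ ≤ |D₁ - D₂| + |D₃| + |D₄| := by gcongr; exact abs_sub _ _
          _ ≤ |D₁| + |D₂| + |D₃| + |D₄| := by gcongr; exact abs_sub _ _
    _ ≤ 2 * (Real.exp (b / 2) + 1) * |t - s| + Real.log M * (2 * Real.sqrt M) * |t - s|
          + |L₀| / 2 * |t - s| + C / 2 * Real.exp (-(a / 2)) := by
        rw [h3]; gcongr
    _ = _ := by ring

/-! ## Step (i): a node-vanishing combination of kernel sections tends to zero -/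

/-- Kernel sections differ by two `Ψ`-differences: `G(t,u) − G(s,u) = (Ψ(t) − Ψ(s)) − (Ψ(t−u) − Ψ(s−u))`. [folklore] -/
theorem zetaScrewKernel_sub (t s u : ℝ) :
    zetaScrewKernel t u - zetaScrewKernel s u = (zetaScrew t - zetaScrew s) - (zetaScrew (t - u) - zetaScrew (s - u)) := by
  rw [zetaScrewKernel_def, zetaScrewKernel_def]; ring

/-- The node `m = ⌊e^t⌋` below `t ≥ log(n+2) + 1` and its elementary inequalities. [folklore] -/
theorem exists_node (n : ℕ) {t : ℝ} (ht : Real.log ((n : ℝ) + 2) + 1 ≤ t) :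
    ∃ m : ℕ, n + 2 ≤ m ∧ Real.log m ≤ t ∧ t ≤ Real.log ((m + 1 : ℕ) : ℝ) ∧
      |t - Real.log m| ≤ 2 * Real.exp (-t) ∧ Real.exp (-(Real.log m / 2)) ≤ 2 * Real.exp (-(t / 2)) ∧
      Real.log ((m + 1 : ℕ) : ℝ) ≤ t + 1 ∧ Real.sqrt ((m + 1 : ℕ) : ℝ) ≤ Real.exp ((t + 1) / 2) := by
  have hlog0 : 0 ≤ Real.log ((n : ℝ) + 2) := Real.log_nonneg (by linarith [n.cast_nonneg (α := ℝ)])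
  have ht0 : 0 ≤ t := by linarith
  have hexp_ge : (n : ℝ) + 2 ≤ Real.exp t := by
    have : Real.exp (Real.log ((n : ℝ) + 2)) ≤ Real.exp t := Real.exp_le_exp.2 (by linarith)
    rwa [Real.exp_log (by positivity)] at this
  obtain ⟨m, hm⟩ : ∃ m : ℕ, m = ⌊Real.exp t⌋₊ := ⟨_, rfl⟩
  have hm_ge : n + 2 ≤ m := by rw [hm]; exact Nat.le_floor (by exact_mod_cast hexp_ge)
  have hm1 : (1 : ℝ) ≤ m := by exact_mod_cast (show 1 ≤ m by omega)
  have hm0 : (0 : ℝ) < m := by linarith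
  have hm_le : (m : ℝ) ≤ Real.exp t := by rw [hm]; exact Nat.floor_le (Real.exp_pos t).le
  have hm_lt : Real.exp t < m + 1 := by rw [hm]; exact Nat.lt_floor_add_one _
  have hMR : ((m + 1 : ℕ) : ℝ) = (m : ℝ) + 1 := by push_cast; ring
  have hs_le : Real.log m ≤ t := (Real.log_le_iff_le_exp hm0).2 hm_le
  have ht_le : t ≤ Real.log ((m + 1 : ℕ) : ℝ) := by
    rw [hMR, Real.le_log_iff_exp_le (by positivity)]; exact hm_lt.le
  have hexp1 : Real.exp t + 1 ≤ Real.exp (t + 1) := by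
    rw [Real.exp_add]
    have h1 : 1 ≤ Real.exp t := Real.one_le_exp ht0
    have h2 : (2 : ℝ) ≤ Real.exp 1 := by have := Real.add_one_le_exp (1 : ℝ); linarith
    nlinarith
  have hM1 : (m : ℝ) + 1 ≤ Real.exp (t + 1) := le_trans (by linarith) hexp1
  refine ⟨m, hm_ge, hs_le, ht_le, ?_, ?_, ?_, ?_⟩
  · -- spacing
    rw [abs_of_nonneg (sub_nonneg.2 hs_le)]
    have h1 : t - Real.log m ≤ Real.log (((m : ℝ) + 1) / m) := by
      rw [Real.log_div (by positivity) hm0.ne']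
      rw [hMR] at ht_le
      linarith
    have h2 : Real.log (((m : ℝ) + 1) / m) ≤ 1 / m := by
      have := Real.log_le_sub_one_of_pos (x := ((m : ℝ) + 1) / m) (by positivity)
      have e : ((m : ℝ) + 1) / m - 1 = 1 / m := by rw [div_sub_one hm0.ne']; ring_nf
      rwa [e] at this
    have h3 : 1 / (m : ℝ) ≤ 2 * Real.exp (-t) := by
      rw [Real.exp_neg, div_le_iff₀ hm0, show 2 * (Real.exp t)⁻¹ * m = 2 * m / Real.exp t by ring,
        le_div_iff₀ (Real.exp_pos t)]
      linarith
    linarith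
  · -- `e^{-s/2} ≤ 2 e^{-t/2}`
    have h1 : Real.exp t ≤ m * 2 := by linarith
    have h2 : t - Real.log 2 ≤ Real.log m := by
      rw [sub_le_iff_le_add, ← Real.log_mul hm0.ne' (by norm_num)]
      exact (Real.le_log_iff_exp_le (by positivity)).2 h1
    have h3 : Real.exp (-(Real.log m / 2)) ≤ Real.exp (Real.log 2 / 2 + -(t / 2)) :=
      Real.exp_le_exp.2 (by linarith)
    rw [Real.exp_add] at h3
    have h4 : Real.exp (Real.log 2 / 2) ≤ 2 := by
      calc Real.exp (Real.log 2 / 2) ≤ Real.exp (Real.log 2) :=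
            Real.exp_le_exp.2 (by linarith [Real.log_nonneg (x := (2 : ℝ)) (by norm_num)])
        _ = 2 := Real.exp_log (by norm_num)
    calc Real.exp (-(Real.log m / 2)) ≤ Real.exp (Real.log 2 / 2) * Real.exp (-(t / 2)) := h3
      _ ≤ 2 * Real.exp (-(t / 2)) := by gcongr
  · rw [Real.log_le_iff_le_exp (by positivity), hMR]; exact hM1
  · rw [Real.sqrt_le_iff]
    refine ⟨(Real.exp_pos _).le, ?_⟩
    have e : Real.exp ((t + 1) / 2) ^ 2 = Real.exp (t + 1) := by rw [sq, ← Real.exp_add]; ring_nf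
    rw [e, hMR]; exact hM1

/-- **One kernel section near a node.** For `0 ≤ u ≤ s ≤ t ≤ b`, `e^b ≤ M`, with the Lipschitz constant `Lip` of
`abs_zetaScrew_sub_le` and `C = Σ (k+¼)^{-2}`:
`|G(t,u) − G(s,u)| ≤ 2·Lip·|t−s| + (C/2)(e^{-s/2} + e^{u/2}e^{-s/2})`. [folklore] -/
theorem abs_kernel_section_sub_le {u s t b : ℝ} {M : ℕ} (hu : 0 ≤ u) (hus : u ≤ s) (hst : s ≤ t)
    (htb : t ≤ b) (hM : Real.exp b ≤ M) :
    |zetaScrewKernel t u - zetaScrewKernel s u| ≤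
      2 * (2 * (Real.exp (b / 2) + 1) + Real.log M * (2 * Real.sqrt M)
          + |Real.eulerMascheroniConstant + π / 2 + 3 * Real.log 2 + Real.log π| / 2) * |t - s|
        + (∑' k : ℕ, 1 / ((k : ℝ) + 1 / 4) ^ 2) / 2 * (Real.exp (-(s / 2)) + Real.exp (u / 2) * Real.exp (-(s / 2))) := by
  have hs0 : 0 ≤ s := hu.trans hus
  have hA := abs_zetaScrew_sub_le (a := s) (b := b) (s := s) (t := t) (M := M) hs0
    ⟨le_rfl, hst.trans htb⟩ ⟨hst, htb⟩ hM
  have hB := abs_zetaScrew_sub_le (a := s - u) (b := b) (s := s - u) (t := t - u) (M := M)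
    (sub_nonneg.2 hus) ⟨le_rfl, by linarith⟩ ⟨by linarith, by linarith⟩ hM
  rw [show t - u - (s - u) = t - s by ring] at hB
  have e : Real.exp (-((s - u) / 2)) = Real.exp (u / 2) * Real.exp (-(s / 2)) := by
    rw [← Real.exp_add]; ring_nf
  rw [e] at hB
  rw [zetaScrewKernel_sub]
  calc |zetaScrew t - zetaScrew s - (zetaScrew (t - u) - zetaScrew (s - u))|
      ≤ |zetaScrew t - zetaScrew s| + |zetaScrew (t - u) - zetaScrew (s - u)| := abs_sub _ _
    _ ≤ _ := by linarith [hA, hB]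

set_option maxHeartbeats 400000 in
/-- **Pointwise decay bound.** If `F(t) = Σ_j G_g(t, log(j+2)) z_j` vanishes at every node `log m` (`m ≥ 2`), then for
`t ≥ log(n+2) + 1`, comparing with the node `log ⌊e^t⌋` just below `t`,
`|F(t)| ≤ (Σ_j |z_j|)·(8(6 + |L₀|/2) + C(n+2))·(t+2)e^{-t/2}`. [folklore] -/
theorem abs_nodeComb_le (n : ℕ) (z : Fin n → ℝ)
    (hz : ∀ i : ℕ, ∑ j : Fin n, zetaScrewKernel (Real.log ((i + 2 : ℕ) : ℝ))
        (Real.log (((j : ℕ) + 2 : ℕ) : ℝ)) * z j = 0)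
    {t : ℝ} (ht : Real.log ((n : ℝ) + 2) + 1 ≤ t) :
    |∑ j : Fin n, zetaScrewKernel t (Real.log (((j : ℕ) + 2 : ℕ) : ℝ)) * z j| ≤
      (∑ j : Fin n, |z j|) *
        ((8 * (6 + |Real.eulerMascheroniConstant + π / 2 + 3 * Real.log 2 + Real.log π| / 2)
          + (∑' k : ℕ, 1 / ((k : ℝ) + 1 / 4) ^ 2) * ((n : ℝ) + 2)) * ((t + 2) * Real.exp (-(t / 2)))) := by
  set L₀ : ℝ := Real.eulerMascheroniConstant + π / 2 + 3 * Real.log 2 + Real.log π with hL₀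
  set C : ℝ := ∑' k : ℕ, 1 / ((k : ℝ) + 1 / 4) ^ 2 with hC
  have hC0 : 0 ≤ C := tsum_nonneg fun k ↦ by positivity
  have hlog0 : 0 ≤ Real.log ((n : ℝ) + 2) := Real.log_nonneg (by linarith [n.cast_nonneg (α := ℝ)])
  have ht0 : 0 ≤ t := by linarith
  obtain ⟨m, hm_ge, hs_le, ht_le, hts, hes, hlogM, hsqrtM⟩ := exists_node n ht
  have hm2 : 2 ≤ m := le_trans (by omega) hm_ge
  have hm0 : (0 : ℝ) < m := by exact_mod_cast (show 0 < m by omega)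
  set s : ℝ := Real.log m with hs
  set M : ℕ := m + 1 with hM
  set b : ℝ := Real.log (M : ℝ) with hb
  set E : ℝ := Real.exp ((t + 1) / 2) with hE
  have hE1 : 1 ≤ E := Real.one_le_exp (by positivity)
  have hM0 : (0 : ℝ) < (M : ℝ) := by positivity
  have hexp_b : Real.exp b ≤ M := by rw [hb, Real.exp_log hM0]
  have hexp_half : Real.exp (b / 2) ≤ E := Real.exp_le_exp.2 (by linarith)
  -- `F(s) = 0`
  have hnode : ∑ j : Fin n, zetaScrewKernel s (Real.log (((j : ℕ) + 2 : ℕ) : ℝ)) * z j = 0 := by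
    have h := hz (m - 2)
    have e : ((m - 2 + 2 : ℕ) : ℝ) = (m : ℝ) := by rw [Nat.sub_add_cancel hm2]
    rwa [e] at h
  set Lip : ℝ := 2 * (Real.exp (b / 2) + 1) + Real.log (M : ℝ) * (2 * Real.sqrt (M : ℝ)) + |L₀| / 2
    with hLipdef
  have hLip : Lip ≤ (6 + |L₀| / 2) * ((t + 2) * E) := lip_le ht0 hE1 hexp_half hlogM hsqrtM
  have hEexp : E * (2 * Real.exp (-t)) ≤ 4 * Real.exp (-(t / 2)) := exp_half_mul_le t
  -- per-section bound
  have hsec : ∀ j : Fin n,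
      |zetaScrewKernel t (Real.log (((j : ℕ) + 2 : ℕ) : ℝ)) - zetaScrewKernel s (Real.log (((j : ℕ) + 2 : ℕ) : ℝ))|
        ≤ (8 * (6 + |L₀| / 2) + C * ((n : ℝ) + 2)) * ((t + 2) * Real.exp (-(t / 2))) := by
    intro j
    set u : ℝ := Real.log (((j : ℕ) + 2 : ℕ) : ℝ) with hu
    have hj2 : (0 : ℝ) < (((j : ℕ) + 2 : ℕ) : ℝ) := by positivity
    have hu0 : 0 ≤ u := Real.log_nonneg (by exact_mod_cast (show 1 ≤ (j : ℕ) + 2 by omega))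
    have hjm : (((j : ℕ) + 2 : ℕ) : ℝ) ≤ (m : ℝ) := by
      exact_mod_cast (show (j : ℕ) + 2 ≤ m by have := j.2; omega)
    have hus : u ≤ s := Real.log_le_log hj2 hjm
    have hun : Real.exp (u / 2) ≤ (n : ℝ) + 1 := by
      calc Real.exp (u / 2) ≤ Real.exp u := Real.exp_le_exp.2 (by linarith)
        _ = (((j : ℕ) + 2 : ℕ) : ℝ) := Real.exp_log hj2
        _ ≤ (n : ℝ) + 1 := by exact_mod_cast (show (j : ℕ) + 2 ≤ n + 1 by have := j.2; omega)
    have hK := abs_kernel_section_sub_le (M := M) hu0 hus hs_le ht_le hexp_b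
    rw [← hLipdef, ← hC] at hK
    have hlipt : 2 * Lip * |t - s| ≤ 2 * ((6 + |L₀| / 2) * ((t + 2) * E)) * (2 * Real.exp (-t)) := by
      have hLip0 : 0 ≤ Lip := by rw [hLipdef]; positivity
      exact mul_le_mul (by linarith) hts (abs_nonneg _) (by positivity)
    have htail : C / 2 * (Real.exp (-(s / 2)) + Real.exp (u / 2) * Real.exp (-(s / 2)))
        ≤ C * ((n : ℝ) + 2) * Real.exp (-(t / 2)) := by
      have h1 : Real.exp (u / 2) * Real.exp (-(s / 2)) ≤ ((n : ℝ) + 1) * (2 * Real.exp (-(t / 2))) :=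
        mul_le_mul hun hes (Real.exp_pos _).le (by positivity)
      have h2 : Real.exp (-(s / 2)) + Real.exp (u / 2) * Real.exp (-(s / 2)) ≤
          2 * ((n : ℝ) + 2) * Real.exp (-(t / 2)) := by linarith
      calc C / 2 * (Real.exp (-(s / 2)) + Real.exp (u / 2) * Real.exp (-(s / 2)))
          ≤ C / 2 * (2 * ((n : ℝ) + 2) * Real.exp (-(t / 2))) := by gcongr
        _ = C * ((n : ℝ) + 2) * Real.exp (-(t / 2)) := by ring
    have hmain : 2 * ((6 + |L₀| / 2) * ((t + 2) * E)) * (2 * Real.exp (-t))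
        ≤ 8 * (6 + |L₀| / 2) * ((t + 2) * Real.exp (-(t / 2))) := by
      have h6 : 0 ≤ 6 + |L₀| / 2 := by positivity
      have := mul_le_mul_of_nonneg_left hEexp (mul_nonneg h6 (by linarith : (0 : ℝ) ≤ t + 2))
      nlinarith [this]
    have hlast : C * ((n : ℝ) + 2) * Real.exp (-(t / 2)) ≤ C * ((n : ℝ) + 2) * ((t + 2) * Real.exp (-(t / 2))) := by
      have : Real.exp (-(t / 2)) ≤ (t + 2) * Real.exp (-(t / 2)) := by nlinarith [Real.exp_pos (-(t / 2))]
      exact mul_le_mul_of_nonneg_left this (by positivity)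
    calc _ ≤ 2 * Lip * |t - s| + C / 2 * (Real.exp (-(s / 2)) + Real.exp (u / 2) * Real.exp (-(s / 2))) := hK
      _ ≤ 8 * (6 + |L₀| / 2) * ((t + 2) * Real.exp (-(t / 2))) + C * ((n : ℝ) + 2) * ((t + 2) * Real.exp (-(t / 2))) := by
          linarith
      _ = _ := by ring
  -- sum over the sections
  have hF : ∑ j : Fin n, zetaScrewKernel t (Real.log (((j : ℕ) + 2 : ℕ) : ℝ)) * z j =
      ∑ j : Fin n, (zetaScrewKernel t (Real.log (((j : ℕ) + 2 : ℕ) : ℝ)) -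
        zetaScrewKernel s (Real.log (((j : ℕ) + 2 : ℕ) : ℝ))) * z j := by
    simp_rw [sub_mul, Finset.sum_sub_distrib, hnode, sub_zero]
  rw [hF]
  calc |∑ j : Fin n, (zetaScrewKernel t (Real.log (((j : ℕ) + 2 : ℕ) : ℝ)) -
          zetaScrewKernel s (Real.log (((j : ℕ) + 2 : ℕ) : ℝ))) * z j|
      ≤ ∑ j : Fin n, |(zetaScrewKernel t (Real.log (((j : ℕ) + 2 : ℕ) : ℝ)) -
          zetaScrewKernel s (Real.log (((j : ℕ) + 2 : ℕ) : ℝ))) * z j| := Finset.abs_sum_le_sum_abs _ _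
    _ ≤ ∑ j : Fin n, (8 * (6 + |L₀| / 2) + C * ((n : ℝ) + 2)) * ((t + 2) * Real.exp (-(t / 2))) * |z j| := by
        refine Finset.sum_le_sum fun j _ ↦ ?_
        rw [abs_mul]
        exact mul_le_mul_of_nonneg_right (hsec j) (abs_nonneg _)
    _ = _ := by rw [← Finset.mul_sum]; ring

/-- **Step (i) of the null-combination theorem.** A real combination of screw-kernel sections
`t ↦ Σ_j G_g(t, log(j+2)) z_j` vanishing at every node `log(i+2)`, `i ∈ ℕ`, tends to `0` as `t → +∞`. [folklore] -/
theorem tendsto_nodeComb_zero (n : ℕ) (z : Fin n → ℝ)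
    (hz : ∀ i : ℕ, ∑ j : Fin n, zetaScrewKernel (Real.log ((i + 2 : ℕ) : ℝ))
        (Real.log (((j : ℕ) + 2 : ℕ) : ℝ)) * z j = 0) :
    Tendsto (fun t : ℝ ↦ ∑ j : Fin n, zetaScrewKernel t (Real.log (((j : ℕ) + 2 : ℕ) : ℝ)) * z j)
      atTop (𝓝 0) := by
  set K : ℝ := (∑ j : Fin n, |z j|) *
    (8 * (6 + |Real.eulerMascheroniConstant + π / 2 + 3 * Real.log 2 + Real.log π| / 2)
      + (∑' k : ℕ, 1 / ((k : ℝ) + 1 / 4) ^ 2) * ((n : ℝ) + 2)) with hK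
  -- `(t + 2) e^{-t/2} → 0`
  have hdec : Tendsto (fun t : ℝ ↦ (t + 2) * Real.exp (-(t / 2))) atTop (𝓝 0) := by
    have h1 : Tendsto (fun x : ℝ ↦ x ^ 1 * Real.exp (-x)) atTop (𝓝 0) :=
      Real.tendsto_pow_mul_exp_neg_atTop_nhds_zero 1
    have h2 : Tendsto (fun t : ℝ ↦ t / 2) atTop atTop := tendsto_id.atTop_div_const (by norm_num)
    have h3 := h1.comp h2
    have h4 : Tendsto (fun t : ℝ ↦ Real.exp (-(t / 2))) atTop (𝓝 0) :=
      Real.tendsto_exp_atBot.comp (tendsto_neg_atTop_atBot.comp h2)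
    have h5 := (h3.const_mul 2).add (h4.const_mul 2)
    simp only [mul_zero, add_zero] at h5
    refine h5.congr fun t ↦ ?_
    simp only [Function.comp_apply, pow_one]
    ring
  have hmaj : Tendsto (fun t : ℝ ↦ K * ((t + 2) * Real.exp (-(t / 2)))) atTop (𝓝 0) := by
    simpa using hdec.const_mul K
  refine squeeze_zero_norm' ?_ hmaj
  filter_upwards [eventually_ge_atTop (Real.log ((n : ℝ) + 2) + 1)] with t ht
  rw [Real.norm_eq_abs]
  calc _ ≤ _ := abs_nodeComb_le n z hz ht
    _ = K * ((t + 2) * Real.exp (-(t / 2))) := by rw [hK]; ring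

end Summit.RiemannHypothesis.RiemannHypothesis.Theorems.Splittings.ScrewNullComb

end
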